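import Literature.AnabelianGeometry.EtaleTheta.BiKummerRootComposition
import Literature.AnabelianGeometry.EtaleTheta.BiKummerOfModelCanonical
import HarnessLib

/-!
# GAP G-L2t4-1c DISCHARGED at the model: the pull-back of birational units is multiplicative

S. Mochizuki, *The étale theta function …*, Publ. RIMS **45** (2009), Prop. 4.2 (iii) p. 314 (PDF p. 88)
(the pull-back `((α')^birat)^*` of birational units along a morphism), Def. 4.1 p. 312 (PDF p. 86), and
S. Mochizuki, *The geometry of Frobenioids I*, Thm. 5.2 (ii) p. 101 («`O^×(−)` on `C^birat` is `B`», a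
functor to monoids) [cite: MochizukiEtTh2009, Prop 4.2 p.314 (PDF p.88)]. Cell abc-iut, layer L2; L2-lead
rulings #11 (R87) row «G-L2t4-1c» to seat abc-iut-L2-t5 (gen 4). PROOF-ONLY (no definition, no named fact).

GAP-LEDGER G-L2t4-1c (sub-row (C3) of G-L2t4-1, abc-iut-w5-d234's `BiKummerSetting.NthRoot.comp` /
`hcomp_of`, `BiKummerRootComposition.lean` p424490): over abc-iut-L2-t3's ABSTRACT §4 setting the pull-back
`pullFrac : (A' ⟶ A) → O^×(A^birat) → O^×(A'^birat)` is a BARE FUNCTION parameter, so the multiplicativity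
`hpow : ∀ x n, pullFrac α₁ (x ^ n) = pullFrac α₁ x ^ n` had to be a binder. At abc-iut-L2-t9's MODEL
(`BiKummerSetting.mkOfModel`, `O^×(A^birat) := B(A_D)^×`, `pullFrac := pullFracModel`) the pull-back IS a
monoid homomorphism `pullFracModel φ : B(A_D)^× →* B(A'_D)^×` (`Units.map` of the functor `B` on
`Base φ`), so (C3) holds by `map_pow`:

* `TemperedFrobenioid.pullFracModel_pow` / `_zpow` / `_mul` / `_inv` — the laws;
* `TemperedFrobenioid.hpow_pullFracModel` — (C3) in the EXACT binder shape of `NthRoot.hcomp_of` with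
  `pullFrac := fun φ x => tf.pullFracModel φ x`;
* `BiKummerSetting.NthRoot.hcomp_of_mkOfModel` / `hcomp_of_mkOfModelCanonical` — w5-d234's `hcomp_of` at
  the two model instances of the §4 setting (`pullFrac := pullFracModel`), with the (C3) binder DISCHARGED;
  the remaining binders are exactly (C1) `Dc`, (C1′) `hD`, (C2) `hsat` (GAP rows G-L2t4-1a and G-L2t4-1b, model-level
  inputs).

HONEST FRAMING: kernel bookkeeping; nothing here bears on the disputed [IUTchIII] Cor. 3.12; typed ≠ proved
for the abstract interface.
-/

noncomputable section

namespace Literature.AnabelianGeometry.EtaleTheta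

open CategoryTheory Literature.AlgebraicGeometry.Frobenioids

universe u₀ v₀ u v w

namespace TemperedFrobenioid

variable {D₀ : Type u₀} [Category.{v₀} D₀] {V : FrdIMonoidStub.{w}}
  {T : RealifiedDivisorMonoids (D₀ := D₀) V} {D : Type u} [Category.{v} D]
  {VD : FrdICatStub.{u, v, w} D} (C : TemperedFrobenioid T D VD)

/-- **`((α')^birat)^*(x^n) = (((α')^birat)^* x)^n`** — the model's pull-back of birational units
`pullFracModel φ = B(Base φ)|_{units}` is a monoid homomorphism ([FrdI] Thm. 5.2 (ii): `B` is a functor to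
monoids). GAP G-L2t4-1c at the model. [cite: MochizukiEtTh2009, Prop 4.2 p.314 (PDF p.88)] -/
theorem pullFracModel_pow {A A' : C.category} (φ : A' ⟶ A) (x : C.biratUnitsModel A) (n : ℕ) :
    C.pullFracModel φ (x ^ n) = C.pullFracModel φ x ^ n :=
  map_pow _ x n

/-- Integer powers: `((α')^birat)^*(x^n) = (((α')^birat)^* x)^n`, `n ∈ ℤ`. [cite: MochizukiEtTh2009, Prop 4.2 p.314 (PDF p.88)] -/
theorem pullFracModel_zpow {A A' : C.category} (φ : A' ⟶ A) (x : C.biratUnitsModel A) (n : ℤ) :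
    C.pullFracModel φ (x ^ n) = C.pullFracModel φ x ^ n :=
  map_zpow _ x n

/-- Products: `((α')^birat)^*(x·y) = ((α')^birat)^* x · ((α')^birat)^* y`. [cite: MochizukiEtTh2009, Prop 4.2 p.314 (PDF p.88)] -/
theorem pullFracModel_mul {A A' : C.category} (φ : A' ⟶ A) (x y : C.biratUnitsModel A) :
    C.pullFracModel φ (x * y) = C.pullFracModel φ x * C.pullFracModel φ y :=
  map_mul _ x y

/-- Inverses: `((α')^birat)^*(x⁻¹) = (((α')^birat)^* x)⁻¹`. [cite: MochizukiEtTh2009, Prop 4.2 p.314 (PDF p.88)] -/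
theorem pullFracModel_inv {A A' : C.category} (φ : A' ⟶ A) (x : C.biratUnitsModel A) :
    C.pullFracModel φ x⁻¹ = (C.pullFracModel φ x)⁻¹ :=
  map_inv _ x

/-- **(C3) of GAP G-L2t4-1 in its binder shape**: for the function `pullFrac := fun φ x => pullFracModel φ x`
of the model, `∀ x n, pullFrac α₁ (x ^ n) = pullFrac α₁ x ^ n` — the `hpow` input of
`BiKummerSetting.NthRoot.comp` / `hcomp_of` / `pow_root_comp`, DISCHARGED. [cite: MochizukiEtTh2009, Prop 4.2 p.314 (PDF p.88)] -/
theorem hpow_pullFracModel {A A' : C.category} (α₁ : A' ⟶ A) :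
    ∀ (x : C.biratUnitsModel A) (n : ℕ),
      (fun {B B' : C.category} (ψ : B' ⟶ B) (y : C.biratUnitsModel B) => C.pullFracModel ψ y) α₁ (x ^ n) =
        (fun {B B' : C.category} (ψ : B' ⟶ B) (y : C.biratUnitsModel B) => C.pullFracModel ψ y) α₁ x ^ n :=
  fun x n => map_pow _ x n

end TemperedFrobenioid

/-! ### w5-d234's composite root with (C3) discharged at the model instances -/

namespace BiKummerSetting

variable {K : Type u₀} [Field K] (X : SemiGraphs.TemperedArithmeticGroup.{u₀} K) {D₀ : Type u₀}
  [Category.{v₀} D₀] {V : FrdIMonoidStub.{w}} {T : RealifiedDivisorMonoids (D₀ := D₀) V} {D : Type u}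
  [Category.{v} D] {VD : FrdICatStub.{u, v, w} D}
  (tf : TemperedFrobenioid T D VD) (hZ : tf.monoidType = MonoidType.Z)
  (hP : ∀ A : Dᵒᵖ, IsPerfect (tf.Φ.carrier A)) (hBΛ : ∀ (Y : D₀ᵒᵖ) (b : T.BΛ.obj Y), IsUnit b)
  (DS : ∀ {A : Dᵒᵖ}, tf.Φ.carrier A → tf.Φ.carrier A → Prop) (IG : D → Prop)
  (gS : ∀ A : D, IG A → (X.Pi →* Aut A)) (gSs : ∀ (A : D) (h : IG A), Function.Surjective (gS A h))
  (NH : Subgroup (Field.absoluteGaloisGroup K) → tf.category → ℕ+ → Prop)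
  (AB : ∀ {A B : tf.category}, Subgroup (Aut A) → (A ⟶ A) → (A ⟶ B) → Prop) (A₀ : tf.category)
  (hA₀ : PreFrobenioid.IsFrobeniusTrivial tf.toElem A₀) (hA₀' : IG A₀.base)

namespace NthRoot

/-- **(C3) at `mkOfModel` for any rendering of the pull-back that agrees with `pullFracModel`**: if
`pullFrac ψ y = pullFracModel ψ y` pointwise, then `pullFrac α₁ (x ^ n) = pullFrac α₁ x ^ n`.
[cite: MochizukiEtTh2009, Prop 4.2 p.314 (PDF p.88)] -/
theorem hpow_of_eq_pullFracModel
    {pullFrac : ∀ {B B' : (mkOfModel X tf hZ hP hBΛ DS IG gS gSs NH AB A₀ hA₀ hA₀').C} (_ : B' ⟶ B),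
      (mkOfModel X tf hZ hP hBΛ DS IG gS gSs NH AB A₀ hA₀ hA₀').biratUnits B →
        (mkOfModel X tf hZ hP hBΛ DS IG gS gSs NH AB A₀ hA₀ hA₀').biratUnits B'}
    (hF : ∀ {B B' : (mkOfModel X tf hZ hP hBΛ DS IG gS gSs NH AB A₀ hA₀ hA₀').C} (ψ : B' ⟶ B)
      (y : (mkOfModel X tf hZ hP hBΛ DS IG gS gSs NH AB A₀ hA₀ hA₀').biratUnits B),
      pullFrac ψ y = tf.pullFracModel ψ y)
    {B B' : (mkOfModel X tf hZ hP hBΛ DS IG gS gSs NH AB A₀ hA₀ hA₀').C} (α₁ : B' ⟶ B)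
    (x : (mkOfModel X tf hZ hP hBΛ DS IG gS gSs NH AB A₀ hA₀ hA₀').biratUnits B) (n : ℕ) :
    pullFrac α₁ (x ^ n) = pullFrac α₁ x ^ n := by
  rw [hF, hF]
  exact map_pow (tf.pullFracModel α₁) x n

/-- **[EtTh] Prop. 5.2 (i) / Rmk. 4.3.2 composite root at `mkOfModel`, (C3) discharged**: for the §4 setting
`mkOfModel` (birational units `B(A_D)^×`) and any rendering `pullFrac` of the pull-back agreeing with
`pullFracModel`, an `N`-th root `R` of the pair of an `l`-th root `Rl` of `θ` IS an `l·N`-th root of `θ`'s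
pair, modulo ONLY the composite base-Frobenius datum (C1) `Dc`, its pull-back compatibility (C1′) `hD` and
the `(l·N, H_⊙)`-saturation (C2) `hsat` (GAP rows G-L2t4-1a and G-L2t4-1b); the multiplicativity (C3) is
`map_pow`. [cite: MochizukiEtTh2009, Prop 5.2 (i) p.324 (PDF p.98)] -/
theorem hcomp_of_mkOfModel
    {pullFrac : ∀ {B B' : (mkOfModel X tf hZ hP hBΛ DS IG gS gSs NH AB A₀ hA₀ hA₀').C} (_ : B' ⟶ B),
      (mkOfModel X tf hZ hP hBΛ DS IG gS gSs NH AB A₀ hA₀ hA₀').biratUnits B →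
        (mkOfModel X tf hZ hP hBΛ DS IG gS gSs NH AB A₀ hA₀ hA₀').biratUnits B'}
    (hF : ∀ {B B' : (mkOfModel X tf hZ hP hBΛ DS IG gS gSs NH AB A₀ hA₀ hA₀').C} (ψ : B' ⟶ B)
      (y : (mkOfModel X tf hZ hP hBΛ DS IG gS gSs NH AB A₀ hA₀ hA₀').biratUnits B),
      pullFrac ψ y = tf.pullFracModel ψ y)
    {A Bl : (mkOfModel X tf hZ hP hBΛ DS IG gS gSs NH AB A₀ hA₀ hA₀').C}
    {θ : (mkOfModel X tf hZ hP hBΛ DS IG gS gSs NH AB A₀ hA₀ hA₀').biratUnits A}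
    {Pl : (mkOfModel X tf hZ hP hBΛ DS IG gS gSs NH AB A₀ hA₀ hA₀').FractionPair θ Bl} {lv N : ℕ+}
    (Rl : (mkOfModel X tf hZ hP hBΛ DS IG gS gSs NH AB A₀ hA₀ hA₀').NthRoot θ Pl lv pullFrac)
    (R : (mkOfModel X tf hZ hP hBΛ DS IG gS gSs NH AB A₀ hA₀ hA₀').NthRoot Rl.root Rl.pair N pullFrac)
    (Dc : (mkOfModel X tf hZ hP hBΛ DS IG gS gSs NH AB A₀ hA₀ hA₀').BaseFrobeniusTypeData (R.α ≫ Rl.α))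
    (hD : pullFrac Dc.α₁ θ = pullFrac R.αData.α₁ (pullFrac Rl.αData.α₁ θ))
    (hsat : (mkOfModel X tf hZ hP hBΛ DS IG gS gSs NH AB A₀ hA₀ hA₀').IsSaturated R.AN (lv * N)
      (pullFrac Dc.α₁ θ)) :
    (mkOfModel X tf hZ hP hBΛ DS IG gS gSs NH AB A₀ hA₀ hA₀').PairIsNthRootOf pullFrac
      ((lv : ℕ) * (N : ℕ)) θ R.pair.num R.pair.den :=
  hcomp_of Rl R Dc hD hsat (fun x n => hpow_of_eq_pullFracModel X tf hZ hP hBΛ DS IG gS gSs NH AB A₀ hA₀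
    hA₀' hF R.αData.α₁ x n)

/-- The same at abc-iut-L2-t9's CANONICAL instance `mkOfModelCanonical` ([FrdI] Prop. 4.1 (iii) disjoint
supports, `B₀^Λ` group-like by `T.isUnit_BΛ`, base-Frobenius pairs from the model): (C3) discharged,
(C1)/(C1′)/(C2) by name. [cite: MochizukiEtTh2009, Prop 5.2 (i) p.324 (PDF p.98)] -/
theorem hcomp_of_mkOfModelCanonical
    {pullFrac : ∀ {B B' : (mkOfModelCanonical X tf hZ hP IG gS gSs NH A₀ hA₀ hA₀').C} (_ : B' ⟶ B),
      (mkOfModelCanonical X tf hZ hP IG gS gSs NH A₀ hA₀ hA₀').biratUnits B →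
        (mkOfModelCanonical X tf hZ hP IG gS gSs NH A₀ hA₀ hA₀').biratUnits B'}
    (hF : ∀ {B B' : (mkOfModelCanonical X tf hZ hP IG gS gSs NH A₀ hA₀ hA₀').C} (ψ : B' ⟶ B)
      (y : (mkOfModelCanonical X tf hZ hP IG gS gSs NH A₀ hA₀ hA₀').biratUnits B),
      pullFrac ψ y = tf.pullFracModel ψ y)
    {A Bl : (mkOfModelCanonical X tf hZ hP IG gS gSs NH A₀ hA₀ hA₀').C}
    {θ : (mkOfModelCanonical X tf hZ hP IG gS gSs NH A₀ hA₀ hA₀').biratUnits A}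
    {Pl : (mkOfModelCanonical X tf hZ hP IG gS gSs NH A₀ hA₀ hA₀').FractionPair θ Bl} {lv N : ℕ+}
    (Rl : (mkOfModelCanonical X tf hZ hP IG gS gSs NH A₀ hA₀ hA₀').NthRoot θ Pl lv pullFrac)
    (R : (mkOfModelCanonical X tf hZ hP IG gS gSs NH A₀ hA₀ hA₀').NthRoot Rl.root Rl.pair N pullFrac)
    (Dc : (mkOfModelCanonical X tf hZ hP IG gS gSs NH A₀ hA₀ hA₀').BaseFrobeniusTypeData (R.α ≫ Rl.α))
    (hD : pullFrac Dc.α₁ θ = pullFrac R.αData.α₁ (pullFrac Rl.αData.α₁ θ))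
    (hsat : (mkOfModelCanonical X tf hZ hP IG gS gSs NH A₀ hA₀ hA₀').IsSaturated R.AN (lv * N)
      (pullFrac Dc.α₁ θ)) :
    (mkOfModelCanonical X tf hZ hP IG gS gSs NH A₀ hA₀ hA₀').PairIsNthRootOf pullFrac
      ((lv : ℕ) * (N : ℕ)) θ R.pair.num R.pair.den :=
  hcomp_of Rl R Dc hD hsat (fun x n => by rw [hF, hF]; exact map_pow (tf.pullFracModel R.αData.α₁) x n)

end NthRoot

end BiKummerSetting

end Literature.AnabelianGeometry.EtaleTheta

end
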